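import Literature.NumberTheory.EllipticCurves.FormalGroupLawPadicProofs
import HarnessLib

/-!
# The filtration of `E₁(ℚ_p)` by the formal parameter, the inverse dictionary, and the limit
# logarithm (towards Silverman AEC VII.6.3: `E(ℚ_p) ⊇` finite-index subgroup `≅ ℤ_p`)

Trunk T-NT-EC (Literature/NumberTheory/EllipticCurves). First of three files discharging the named
fact `Literature.NumberTheory.EllipticCurves.exists_finiteIndex_addEquiv_padicInt`
(`BhargavaShankarCounting.lean`; Silverman, *AEC*, Prop. VII.6.3 for `K = ℚ_p`: `E(ℚ_p)` has a
subgroup of finite index isomorphic to `ℤ_p⁺`), from which Lemma 5.16 of Bhargava–Shankar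
(Brumer–Kramer, `brumerKramer_card_quotient_two`) is already derived in the tree
(`brumerKramer_card_quotient_two_of_AEC`). Everything here is for an elliptic curve over `ℚ_p` with
`p`-INTEGRAL Weierstrass equation (`[W.IsIntegral ℤ_[p]]`; the general case is reduced to this one
by a scaling `(x, y) ↦ (u²x, u³y)` in the third file), and everything is at POINTS: the only input
from the formal group is the tree's PROVED `WeierstrassCurve.formalGroupLaw_padicEval_holds`
(`F(z(P), z(Q)) = z(P + Q)` on `E₁(ℚ_p)`, AEC VII.2.2) — no formal-group axiom, invariant
differential or formal logarithm is used.

## Contents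

* `p`-adic evaluation in two variables (`PadicSeriesEvaluation.lean`), three more estimates:
  `hasSum_padicEval₂` / `summable_padicEval₂`; the ORDER BOUND `norm_padicEval₂_le_max_pow`
  (`‖G(u,v)‖ ≤ max(‖u‖,‖v‖)ᵐ` if `G` is integral without terms of degree `< m`); the LIPSCHITZ
  BOUND `norm_padicEval₂_sub_padicEval₂_le` (`‖F(u,v) - F(u',v)‖ ≤ ‖u - u'‖`).
* The INVERSE DICTIONARY (AEC VII.2.2: "the map `𝓜 → E₁(K)`, `z ↦ (z/w(z), -1/w(z))`"):
  `padicEval_formalW_fixedPoint`, `norm_padicEval_formalW` (`‖w(z)‖ = ‖z‖³`),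
  `equation_of_formalParameter`, `exists_isInReductionKernel_formalParameter_eq` — every `z` with
  `‖z‖ < 1` is `z(P)` for some `P ∈ E₁(ℚ_p)`.
* Norms of the parameter on `E₁(ℚ_p)`: `‖z(-P)‖ = ‖z(P)‖`, `‖z(P + Q)‖ ≤ max(‖z(P)‖, ‖z(Q)‖)`,
  and the LINEAR PART of the group law, `coeff_single_zero_formalGroupLaw`,
  `coeff_single_one_formalGroupLaw` (`F = z₁ + z₂ + (deg ≥ 2)`, AEC IV.2), read off from the
  pointwise identities `F(z(P), 0) = z(P)`, `F(0, z(Q)) = z(Q)` at the points with `z = pⁿ`;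
  whence `norm_formalParameter_add_sub_sub_le`:
  **`‖z(P + Q) - z(P) - z(Q)‖ ≤ max(‖z(P)‖, ‖z(Q)‖)²`**.
* Definitions: `WeierstrassCurve.formalFiltration W n` — the subgroups
  `E⁽ⁿ⁾(ℚ_p) = {P ∈ E₁(ℚ_p) : ‖z(P)‖ ≤ p⁻ⁿ}` (AEC IV.3.2's `Ê(𝓜ⁿ)` transported by VII.2.2;
  `E⁽⁰⁾ = E₁(ℚ_p)`), and `WeierstrassCurve.padicLimitLog W P = lim_k z(pᵏP)/pᵏ`, the limit
  logarithm (convergence, additivity, `E⁽ⁿ⁾ ≅ ℤ_p` for `n ≥ 2` and the finite index are the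
  companion files `PadicPointsFiltrationProofs.lean`, `PadicPointsFiniteIndexProofs.lean`).

## Sources

* J. H. Silverman, *The Arithmetic of Elliptic Curves*, 2nd ed., GTM 106 (2009): IV.1
  (pp. 115–118: `w(z)`, `(x(z), y(z))`, `F(z₁, z₂)`), IV.2.1 (`F(X, Y) = X + Y +` (degree `≥ 2`)),
  IV.3.2(a) (`Ê(𝓜ⁿ)`), VII.2.2 (`E₁(K) ≅ Ê(𝓜)` via `z = -x/y`), VII.6.3 (`SilvermanAEC2009`).

## Design notes

* Curve-dependent declarations are deliberate dot-notation extensions of Mathlib's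
  `WeierstrassCurve` (as in `FormalGroup.lean`, `FormalGroupLawPadicProofs.lean`); the generic
  evaluation lemmas live in `Literature.NumberTheory.EllipticCurves` next to `padicEval₂`.
* The linear coefficients of `F` are obtained analytically (a `p`-adic number of norm `≤ p⁻ⁿ` for
  all `n` vanishes) rather than by a coefficient computation through `MvPowerSeries.subst`.
-/

noncomputable section

open Filter PowerSeries
open scoped Topology

namespace Literature.NumberTheory.EllipticCurves

section Analytic

variable {p : ℕ} [Fact p.Prime] {F : MvPowerSeries (Fin 2) ℚ_[p]} {u v : ℚ_[p]}

/-- The series defining `F(u, v)` sums to it (integral `F`, `‖u‖, ‖v‖ < 1`): Mathlib's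
topological evaluation on the `ℤ_p`-side, pushed to `ℚ_p`. [Bourbaki, Algèbre IV §4 no. 3] [folklore] -/
theorem hasSum_padicEval₂ (hF : IsPadicInt F) (hu : ‖u‖ < 1) (hv : ‖v‖ < 1) :
    HasSum (fun d : Fin 2 →₀ ℕ => MvPowerSeries.coeff d F * (u ^ d 0 * v ^ d 1))
      (padicEval₂ F u v) := by
  obtain ⟨G, rfl⟩ := isPadicInt_iff_exists_map.mp hF
  obtain ⟨u, rfl, hu'⟩ := exists_coe_eq_of_norm_lt_one hu
  obtain ⟨v, rfl, hv'⟩ := exists_coe_eq_of_norm_lt_one hv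
  have h := MvPowerSeries.hasSum_eval₂ (φ := RingHom.id ℤ_[p]) continuous_id
    (padicInt_hasEval_pair hu' hv') G
  have h' := h.map PadicInt.Coe.ringHom.toAddMonoidHom continuous_subtype_val
  have hf : (fun d : Fin 2 →₀ ℕ => MvPowerSeries.coeff d (G.map PadicInt.Coe.ringHom) *
      ((u : ℚ_[p]) ^ d 0 * (v : ℚ_[p]) ^ d 1)) =
      (⇑PadicInt.Coe.ringHom.toAddMonoidHom ∘ fun d =>
        (RingHom.id ℤ_[p]) (MvPowerSeries.coeff d G) * d.prod fun s e => ![u, v] s ^ e) := by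
    funext d; simp
  rw [hf, padicEval₂_map G hu' hv', evalHom₂_apply]
  exact h'

/-- Summability of the series defining `F(u, v)`. [folklore] -/
theorem summable_padicEval₂ (hF : IsPadicInt F) (hu : ‖u‖ < 1) (hv : ‖v‖ < 1) :
    Summable fun d : Fin 2 →₀ ℕ => MvPowerSeries.coeff d F * (u ^ d 0 * v ^ d 1) :=
  (hasSum_padicEval₂ hF hu hv).summable

/-- **Order bound**: if the integral series `F` has no terms of total degree `< m`, then
`‖F(u, v)‖ ≤ max(‖u‖, ‖v‖)ᵐ` on the open unit disc (each surviving term `a_d u^{d₀} v^{d₁}` has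
norm `≤ r^{d₀+d₁} ≤ rᵐ`, `r = max(‖u‖, ‖v‖) < 1`; ultrametric inequality).
[Silverman AEC IV.1, IV.2 (estimates for power series on `𝓜`)] [folklore] -/
theorem norm_padicEval₂_le_max_pow (hF : IsPadicInt F) {m : ℕ}
    (hFm : ∀ d : Fin 2 →₀ ℕ, d 0 + d 1 < m → MvPowerSeries.coeff d F = 0)
    (hu : ‖u‖ < 1) (hv : ‖v‖ < 1) :
    ‖padicEval₂ F u v‖ ≤ (max ‖u‖ ‖v‖) ^ m := by
  set r := max ‖u‖ ‖v‖ with hr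
  have hr0 : 0 ≤ r := le_max_of_le_left (norm_nonneg u)
  have hr1 : r < 1 := max_lt hu hv
  unfold padicEval₂
  refine IsUltrametricDist.norm_tsum_le_of_forall_le_of_nonneg (pow_nonneg hr0 m) fun d => ?_
  by_cases hd : d 0 + d 1 < m
  · rw [hFm d hd, zero_mul, norm_zero]; exact pow_nonneg hr0 m
  · push Not at hd
    rw [norm_mul, norm_mul, norm_pow, norm_pow]
    calc ‖MvPowerSeries.coeff d F‖ * (‖u‖ ^ d 0 * ‖v‖ ^ d 1) ≤ 1 * (r ^ d 0 * r ^ d 1) := by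
          gcongr
          · exact hF d
          · exact le_max_left _ _
          · exact le_max_right _ _
      _ = r ^ (d 0 + d 1) := by rw [one_mul, pow_add]
      _ ≤ r ^ m := pow_le_pow_of_le_one hr0 hr1.le hd

/-- In particular `‖F(u, v)‖ ≤ max(‖u‖, ‖v‖)` when `F(0, 0) = 0`. [folklore] -/
theorem norm_padicEval₂_le_max (hF : IsPadicInt F) (hF0 : MvPowerSeries.constantCoeff F = 0)
    (hu : ‖u‖ < 1) (hv : ‖v‖ < 1) : ‖padicEval₂ F u v‖ ≤ max ‖u‖ ‖v‖ := by
  have h := norm_padicEval₂_le_max_pow hF (m := 1) (fun d hd => ?_) hu hv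
  · rwa [pow_one] at h
  · have h0 : d 0 = 0 := by omega
    have h1 : d 1 = 0 := by omega
    have hd0 : d = 0 := by ext i; fin_cases i <;> simp [h0, h1]
    rw [hd0, MvPowerSeries.coeff_zero_eq_constantCoeff_apply, hF0]

omit [Fact p.Prime] in
/-- `‖uⁿ - u'ⁿ‖ ≤ ‖u - u'‖` for `‖u‖, ‖u'‖ ≤ 1` (ultrametric: `uⁿ⁺¹ - u'ⁿ⁺¹ = u(uⁿ - u'ⁿ) + (u - u')u'ⁿ`).
[folklore] -/
theorem padic_norm_pow_sub_pow_le [Fact p.Prime] {u u' : ℚ_[p]} (hu : ‖u‖ ≤ 1) (hu' : ‖u'‖ ≤ 1)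
    (n : ℕ) : ‖u ^ n - u' ^ n‖ ≤ ‖u - u'‖ := by
  induction n with
  | zero => simp
  | succ n ih =>
    have hsplit : u ^ (n + 1) - u' ^ (n + 1) = u * (u ^ n - u' ^ n) + (u - u') * u' ^ n := by ring
    rw [hsplit]
    refine (Padic.nonarchimedean _ _).trans (max_le ?_ ?_)
    · rw [norm_mul]
      exact (mul_le_of_le_one_left (norm_nonneg _) hu).trans ih
    · rw [norm_mul, norm_pow]
      exact mul_le_of_le_one_right (norm_nonneg _) (pow_le_one₀ (norm_nonneg _) hu')

/-- **Lipschitz bound in the first variable**: `‖F(u, v) - F(u', v)‖ ≤ ‖u - u'‖` for `F` integral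
and `u, u', v` in the open unit disc (termwise `a_d (u^{d₀} - u'^{d₀}) v^{d₁}`, ultrametric).
[Silverman AEC IV.1, IV.2] [folklore] -/
theorem norm_padicEval₂_sub_padicEval₂_le (hF : IsPadicInt F) {u u' v : ℚ_[p]} (hu : ‖u‖ < 1)
    (hu' : ‖u'‖ < 1) (hv : ‖v‖ < 1) :
    ‖padicEval₂ F u v - padicEval₂ F u' v‖ ≤ ‖u - u'‖ := by
  rw [← ((hasSum_padicEval₂ hF hu hv).sub (hasSum_padicEval₂ hF hu' hv)).tsum_eq]
  refine IsUltrametricDist.norm_tsum_le_of_forall_le_of_nonneg (norm_nonneg _) fun d => ?_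
  rw [← mul_sub, ← sub_mul, norm_mul, norm_mul]
  calc ‖MvPowerSeries.coeff d F‖ * (‖u ^ d 0 - u' ^ d 0‖ * ‖v ^ d 1‖) ≤ 1 * (‖u - u'‖ * 1) := by
        gcongr
        · exact hF d
        · exact padic_norm_pow_sub_pow_le hu.le hu'.le _
        · rw [norm_pow]; exact pow_le_one₀ (norm_nonneg _) hv.le
    _ = ‖u - u'‖ := by ring

end Analytic

end Literature.NumberTheory.EllipticCurves

namespace WeierstrassCurve

open scoped Classical
open Literature.NumberTheory.EllipticCurves

variable {p : ℕ} [Fact p.Prime] (W : WeierstrassCurve ℚ_[p])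

/-! ### The inverse dictionary `pℤ_p → E₁(ℚ_p)`, `z ↦ (z/w(z), -1/w(z))` (AEC IV.1, VII.2.2) -/

section InverseDictionary

variable [hW : W.IsIntegral ℤ_[p]]

/-- **The fixed-point identity at any point of the disc**: `ŵ = f(z, ŵ)` for `ŵ = w(z)`, `‖z‖ < 1`
(AEC IV.1.1(a) evaluated through the integral model). [Silverman AEC IV.1.1(a)] [folklore] -/
theorem padicEval_formalW_fixedPoint {z : ℚ_[p]} (hz : ‖z‖ < 1) :
    padicEval W.formalW z = z ^ 3 + W.a₁ * z * padicEval W.formalW z +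
      W.a₂ * z ^ 2 * padicEval W.formalW z + W.a₃ * padicEval W.formalW z ^ 2 +
      W.a₄ * z * padicEval W.formalW z ^ 2 + W.a₆ * padicEval W.formalW z ^ 3 := by
  obtain ⟨z', hz', hz1'⟩ := exists_coe_eq_of_norm_lt_one hz
  set V := W.integralModel ℤ_[p]
  have hV := W.eq_map_integralModel
  have hŵ : padicEval W.formalW z = (evalHom z' hz1' V.formalW : ℤ_[p]) := by
    rw [← hz', ← padicEval_map V.formalW hz1', map_formalW, hV]
  have key := congrArg ((↑) : ℤ_[p] → ℚ_[p]) (evalHom_formalW_fixed V z' hz1')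
  push_cast at key
  rw [← hŵ, hz'] at key
  have ha₁ : (V.a₁ : ℚ_[p]) = W.a₁ := by rw [← hV, map_a₁]; rfl
  have ha₂ : (V.a₂ : ℚ_[p]) = W.a₂ := by rw [← hV, map_a₂]; rfl
  have ha₃ : (V.a₃ : ℚ_[p]) = W.a₃ := by rw [← hV, map_a₃]; rfl
  have ha₄ : (V.a₄ : ℚ_[p]) = W.a₄ := by rw [← hV, map_a₄]; rfl
  have ha₆ : (V.a₆ : ℚ_[p]) = W.a₆ := by rw [← hV, map_a₆]; rfl
  rw [ha₁, ha₂, ha₃, ha₄, ha₆] at key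
  exact key

/-- **`‖w(z)‖ = ‖z‖³`** on the disc: `w = z³ B(z)` with `B(0) = 1`, so `‖B(z)‖ = 1`.
[Silverman AEC IV.1.1(a) (`w(z) = z³(1 + A₁z + ⋯)`)] [folklore] -/
theorem norm_padicEval_formalW {z : ℚ_[p]} (hz : ‖z‖ < 1) :
    ‖padicEval W.formalW z‖ = ‖z‖ ^ 3 := by
  have hB : IsPadicInt W.formalWDivCube := W.isPadicInt_formalWDivCube
  have hB1 : IsPadicInt (W.formalWDivCube - 1) := hB.sub IsPadicInt.one
  have hB10 : constantCoeff (W.formalWDivCube - 1) = 0 := by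
    rw [map_sub, constantCoeff_formalWDivCube, map_one, sub_self]
  have he : ‖padicEval (W.formalWDivCube - 1) z‖ < 1 := norm_padicEval_lt_one hB1 hB10 hz
  have hBz : padicEval W.formalWDivCube z = 1 + padicEval (W.formalWDivCube - 1) z := by
    rw [padicEval_sub hB IsPadicInt.one hz, padicEval_one]; ring
  have hnB : ‖padicEval W.formalWDivCube z‖ = 1 := by
    rw [hBz, Padic.add_eq_max_of_ne (by rw [norm_one]; exact he.ne'), norm_one,
      max_eq_left he.le]
  rw [W.formalW_eq_X_pow_mul_formalWDivCube, padicEval_mul (IsPadicInt.powerSeries_X.pow 3) hB hz,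
    padicEval_pow IsPadicInt.powerSeries_X hz, padicEval_X, norm_mul, hnB, mul_one, norm_pow]

/-- **The point with parameter `z`**: for `0 < ‖z‖ < 1` and `ŵ = w(z)`, the pair
`(x, y) = (z/ŵ, -1/ŵ)` satisfies the Weierstrass equation (the fixed-point identity divided by
`ŵ³`). [Silverman AEC IV.1 (p. 116: "`(x(z), y(z))` … a formal solution"), VII.2.2]
[cite: SilvermanAEC2009, VII.2.2] -/
theorem equation_of_formalParameter {z : ℚ_[p]} (hz : ‖z‖ < 1) (hz0 : z ≠ 0) :
    W.toAffine.Equation (z / padicEval W.formalW z) (-1 / padicEval W.formalW z) := by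
  set ŵ := padicEval W.formalW z with hŵ
  have hw0 : ŵ ≠ 0 := by
    intro h
    have := W.norm_padicEval_formalW hz
    rw [← hŵ, h, norm_zero] at this
    exact hz0 (norm_eq_zero.mp (pow_eq_zero_iff (n := 3) (by norm_num) |>.mp this.symm))
  have hfix := W.padicEval_formalW_fixedPoint hz
  rw [← hŵ] at hfix
  rw [Affine.equation_iff]
  field_simp
  linear_combination hfix

/-- The `x`-coordinate `z/w(z)` has norm `‖z‖⁻² > 1`: the point lies in `E₁(ℚ_p)`.
[Silverman AEC VII.2.2] [folklore] -/
theorem one_lt_norm_x_of_formalParameter {z : ℚ_[p]} (hz : ‖z‖ < 1) (hz0 : z ≠ 0) :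
    1 < ‖z / padicEval W.formalW z‖ := by
  have hz0' : 0 < ‖z‖ := norm_pos_iff.mpr hz0
  have hz0'' : ‖z‖ ≠ 0 := hz0'.ne'
  rw [norm_div, W.norm_padicEval_formalW hz, show ‖z‖ / ‖z‖ ^ 3 = (‖z‖ ^ 2)⁻¹ by field_simp]
  exact (one_lt_inv₀ (pow_pos hz0' 2)).mpr (pow_lt_one₀ hz0'.le hz two_ne_zero)

/-- **The inverse dictionary** (AEC VII.2.2: "`𝓜 → E₁(K)`, `z ↦ (z/w(z), -1/w(z))` … with inverse
`(x, y) ↦ -x/y`"): every `z` of the open unit disc is the parameter of a point of `E₁(ℚ_p)`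
(`z = 0` ↦ `O`; `z ≠ 0` ↦ an affine point, nonsingular since `E` is an elliptic curve).
[cite: SilvermanAEC2009, VII.2.2] -/
theorem exists_isInReductionKernel_formalParameter_eq [W.IsElliptic] {z : ℚ_[p]} (hz : ‖z‖ < 1) :
    ∃ P : W.toAffine.Point, W.IsInReductionKernel P ∧ W.formalParameter P = z := by
  by_cases hz0 : z = 0
  · exact ⟨0, W.isInReductionKernel_zero, by rw [hz0]; rfl⟩
  have heq := W.equation_of_formalParameter hz hz0
  have hns : W.toAffine.Nonsingular (z / padicEval W.formalW z) (-1 / padicEval W.formalW z) :=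
    (Affine.equation_iff_nonsingular).mp heq
  have hw0 : padicEval W.formalW z ≠ 0 := by
    intro h
    have := W.norm_padicEval_formalW hz
    rw [h, norm_zero] at this
    exact hz0 (norm_eq_zero.mp (pow_eq_zero_iff (n := 3) (by norm_num) |>.mp this.symm))
  refine ⟨.some _ _ hns, (W.isInReductionKernel_some hns).mpr
    (W.one_lt_norm_x_of_formalParameter hz hz0), ?_⟩
  rw [W.formalParameter_some hns]
  field_simp

end InverseDictionary

/-! ### The parameter on `E₁(ℚ_p)`: norms -/

section ParameterNorms

variable [hW : W.IsIntegral ℤ_[p]]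

/-- For `P = (x, y) ∈ E₁(ℚ_p)`: `‖z(P)‖² = ‖x‖⁻¹` (from `‖y‖² = ‖x‖³`). [Silverman AEC VII.2.2
(`v(z(P)) = -v(x)/2`)] [folklore] -/
theorem norm_formalParameter_sq {x y : ℚ_[p]} (heq : W.toAffine.Equation x y) (hx : 1 < ‖x‖) :
    ‖-x / y‖ ^ 2 = ‖x‖⁻¹ := by
  obtain ⟨hsq, hxy⟩ := W.norm_sq_eq_norm_cube heq hx
  have hx0 : 0 < ‖x‖ := one_pos.trans hx
  rw [norm_div, norm_neg, div_pow, hsq, pow_succ ‖x‖ 2, ← div_div, div_self (pow_pos hx0 2).ne',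
    one_div]

/-- `‖z(-P)‖ = ‖z(P)‖`: `-P = (x, -y - a₁x - a₃)` and `‖-y - a₁x - a₃‖ = ‖y‖` (`y` dominates).
[Silverman AEC IV.1 (`i(z) = -z + ⋯`), VII.2.2] [folklore] -/
theorem norm_neg_div_negY {x y : ℚ_[p]} (heq : W.toAffine.Equation x y) (hx : 1 < ‖x‖) :
    ‖-x / W.toAffine.negY x y‖ = ‖-x / y‖ := by
  obtain ⟨h₁, -, h₃, -, -⟩ := W.norm_coeffs_le_one
  obtain ⟨-, hxy⟩ := W.norm_sq_eq_norm_cube heq hx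
  have hy1 : 1 < ‖y‖ := hx.trans hxy
  have hlt : ‖-(W.a₁ * x) - W.a₃‖ < ‖-y‖ := by
    rw [norm_neg, sub_eq_add_neg]
    refine (Padic.nonarchimedean _ _).trans_lt (max_lt ?_ ?_)
    · rw [norm_neg, norm_mul]; exact (mul_le_of_le_one_left (norm_nonneg _) h₁).trans_lt hxy
    · rw [norm_neg]; exact h₃.trans_lt hy1
  have hnegY : ‖W.toAffine.negY x y‖ = ‖y‖ := by
    rw [Affine.negY, show -y - W.a₁ * x - W.a₃ = -y + (-(W.a₁ * x) - W.a₃) by ring,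
      Padic.add_eq_max_of_ne hlt.ne', max_eq_left hlt.le, norm_neg]
  rw [norm_div, norm_div, hnegY]

/-- **`‖z(-P)‖ = ‖z(P)‖` on `E₁(ℚ_p)`.** [Silverman AEC VII.2.2] [folklore] -/
theorem norm_formalParameter_neg {P : W.toAffine.Point} (hP : W.IsInReductionKernel P) :
    ‖W.formalParameter (-P)‖ = ‖W.formalParameter P‖ := by
  rcases P with _ | ⟨x, y, h⟩
  · rfl
  · rw [Affine.Point.neg_some, W.formalParameter_some, W.formalParameter_some h]
    exact W.norm_neg_div_negY h.left hP

omit hW in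
/-- `-P ∈ E₁(ℚ_p)` for `P ∈ E₁(ℚ_p)` (same `x`-coordinate). [Silverman AEC VII.2.2] [folklore] -/
theorem isInReductionKernel_neg {P : W.toAffine.Point} (hP : W.IsInReductionKernel P) :
    W.IsInReductionKernel (-P) := by
  rcases P with _ | ⟨x, y, h⟩
  · exact hP
  · rw [Affine.Point.neg_some]; exact hP

/-- `‖z(P)‖ < 1` on `E₁(ℚ_p)`. [Silverman AEC VII.2.2] [folklore] -/
theorem norm_formalParameter_lt_one {P : W.toAffine.Point} (hP : W.IsInReductionKernel P) :
    ‖W.formalParameter P‖ < 1 := by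
  rcases P with _ | ⟨x, y, h⟩
  · show ‖(0 : ℚ_[p])‖ < 1; rw [norm_zero]; exact one_pos
  · rw [W.formalParameter_some h]; exact (W.param_facts h.left hP).2.2.1

/-- `z(P) = 0 ↔ P = O` on `E₁(ℚ_p)`. [Silverman AEC VII.2.2] [folklore] -/
theorem formalParameter_eq_zero_iff {P : W.toAffine.Point} (hP : W.IsInReductionKernel P) :
    W.formalParameter P = 0 ↔ P = 0 := by
  rcases P with _ | ⟨x, y, h⟩
  · exact ⟨fun _ => rfl, fun _ => rfl⟩
  · rw [W.formalParameter_some h]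
    refine ⟨fun h0 => absurd h0 (W.param_facts h.left hP).2.1, fun h0 => ?_⟩
    exact absurd h0 (by rintro ⟨⟩)

/-- **`‖z(P + Q)‖ ≤ max(‖z(P)‖, ‖z(Q)‖)` on `E₁(ℚ_p)`** (`z(P+Q) = F(z(P), z(Q))`, `F` integral
without constant term). [Silverman AEC VII.2.2, IV.1] [folklore] -/
theorem norm_formalParameter_add_le [W.IsElliptic] {P Q : W.toAffine.Point} (hP : W.IsInReductionKernel P)
    (hQ : W.IsInReductionKernel Q) :
    ‖W.formalParameter (P + Q)‖ ≤ max ‖W.formalParameter P‖ ‖W.formalParameter Q‖ := by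
  rw [← formalGroupLaw_padicEval_holds p W P Q hP hQ]
  exact norm_padicEval₂_le_max W.isPadicInt_formalGroupLaw W.constantCoeff_formalGroupLaw
    (W.norm_formalParameter_lt_one hP) (W.norm_formalParameter_lt_one hQ)

end ParameterNorms

/-! ### `F(z₁, z₂) = z₁ + z₂ + (deg ≥ 2)`: the linear part of the group law, read off at points -/

section LinearPart

variable [hW : W.IsIntegral ℤ_[p]]

omit hW in
/-- The group law minus a trial linear part `c₁₀ z₁ + c₀₁ z₂` (with `cᵢⱼ` the actual linear
coefficients) has no terms of degree `< 2`. [Silverman AEC IV.2 (`F = X + Y + ⋯`)] [folklore] -/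
theorem coeff_formalGroupLaw_sub_linear_eq_zero (d : Fin 2 →₀ ℕ) (hd : d 0 + d 1 < 2) :
    MvPowerSeries.coeff d (W.formalGroupLaw -
      MvPowerSeries.C (MvPowerSeries.coeff (Finsupp.single 0 1) W.formalGroupLaw) *
        MvPowerSeries.X 0 -
      MvPowerSeries.C (MvPowerSeries.coeff (Finsupp.single 1 1) W.formalGroupLaw) *
        MvPowerSeries.X 1) = 0 := by
  have hcases : d = 0 ∨ d = Finsupp.single 0 1 ∨ d = Finsupp.single 1 1 := by
    rcases Nat.lt_or_ge (d 0 + d 1) 1 with h0 | h1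
    · left
      have h00 : d 0 = 0 := by omega
      have h01 : d 1 = 0 := by omega
      ext i; fin_cases i <;> simp [h00, h01]
    · right
      rcases Nat.eq_zero_or_pos (d 0) with h00 | h00
      · right
        have h01 : d 1 = 1 := by omega
        ext i; fin_cases i <;> simp [h00, h01]
      · left
        have h00' : d 0 = 1 := by omega
        have h01 : d 1 = 0 := by omega
        ext i; fin_cases i <;> simp [h00', h01]
  have hne : (Finsupp.single 0 1 : Fin 2 →₀ ℕ) ≠ Finsupp.single 1 1 := by
    rw [Ne, Finsupp.single_eq_single_iff]; simp
  rcases hcases with rfl | rfl | rfl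
  · simp [W.constantCoeff_formalGroupLaw]
  · simp [MvPowerSeries.coeff_X, hne]
  · simp [MvPowerSeries.coeff_X, hne.symm]

/-- Integrality of the same series. [folklore] -/
theorem isPadicInt_formalGroupLaw_sub_linear :
    IsPadicInt (W.formalGroupLaw -
      MvPowerSeries.C (MvPowerSeries.coeff (Finsupp.single 0 1) W.formalGroupLaw) *
        MvPowerSeries.X 0 -
      MvPowerSeries.C (MvPowerSeries.coeff (Finsupp.single 1 1) W.formalGroupLaw) *
        MvPowerSeries.X 1) :=
  (W.isPadicInt_formalGroupLaw.sub ((IsPadicInt.C (W.isPadicInt_formalGroupLaw _)).mul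
    (IsPadicInt.X 0))).sub ((IsPadicInt.C (W.isPadicInt_formalGroupLaw _)).mul (IsPadicInt.X 1))

variable [W.IsElliptic]

/-- There are points of `E₁(ℚ_p)` with parameter `pⁿ` for every `n ≥ 1` (inverse dictionary).
[Silverman AEC VII.2.2] [folklore] -/
theorem exists_formalParameter_eq_p_pow {n : ℕ} (hn : 1 ≤ n) :
    ∃ P : W.toAffine.Point, W.IsInReductionKernel P ∧ W.formalParameter P = (p : ℚ_[p]) ^ n :=
  W.exists_isInReductionKernel_formalParameter_eq (by
    rw [Padic.norm_p_pow]
    exact zpow_lt_one_of_neg₀ (by exact_mod_cast (Fact.out : p.Prime).one_lt) (by omega))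

/-- A `p`-adic number of norm `≤ p⁻ⁿ` for all `n ≥ 1` is `0`. [folklore] -/
theorem _root_.Literature.NumberTheory.EllipticCurves.padic_eq_zero_of_norm_le_p_pow {c : ℚ_[p]}
    (hc : ∀ n : ℕ, 1 ≤ n → ‖c‖ ≤ ((p : ℝ)⁻¹) ^ n) : c = 0 := by
  have hp1 : 1 < (p : ℝ) := by exact_mod_cast (Fact.out : p.Prime).one_lt
  have ht : Tendsto (fun n : ℕ => ((p : ℝ)⁻¹) ^ n) atTop (𝓝 0) :=
    tendsto_pow_atTop_nhds_zero_of_lt_one (inv_nonneg.mpr (zero_le_one.trans hp1.le))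
      (inv_lt_one_of_one_lt₀ hp1)
  have hle : ‖c‖ ≤ 0 :=
    ge_of_tendsto ht (Filter.eventually_atTop.mpr ⟨1, fun n hn => hc n hn⟩)
  exact norm_eq_zero.mp (le_antisymm hle (norm_nonneg c))

/-- **The linear coefficient of `z₁` in `F` is `1`**, read off at points: `F(z(P), 0) = z(P)`
(chord through `P` and `O`) for the points `P ∈ E₁(ℚ_p)` with `z(P) = pⁿ`, and
`‖F(u, 0) - c₁₀u‖ ≤ ‖u‖²`, force `‖1 - c₁₀‖ ≤ p⁻ⁿ` for all `n`.
[Silverman AEC IV.2.1 / IV.1 (`F(X, Y) = X + Y + ⋯`)] [cite: SilvermanAEC2009, IV.1.1] -/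
theorem coeff_single_zero_formalGroupLaw :
    MvPowerSeries.coeff (Finsupp.single 0 1) W.formalGroupLaw = 1 := by
  set c₁₀ := MvPowerSeries.coeff (Finsupp.single 0 1) W.formalGroupLaw with hc₁₀
  set c₀₁ := MvPowerSeries.coeff (Finsupp.single 1 1) W.formalGroupLaw with hc₀₁
  set H := W.formalGroupLaw - MvPowerSeries.C c₁₀ * MvPowerSeries.X 0 -
    MvPowerSeries.C c₀₁ * MvPowerSeries.X 1 with hH
  have hHint : IsPadicInt H := W.isPadicInt_formalGroupLaw_sub_linear
  have h01 : ‖(0 : ℚ_[p])‖ < 1 := by rw [norm_zero]; exact one_pos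
  suffices hkey : ∀ n : ℕ, 1 ≤ n → ‖1 - c₁₀‖ ≤ ((p : ℝ)⁻¹) ^ n by
    have := padic_eq_zero_of_norm_le_p_pow hkey
    linear_combination -this
  intro n hn
  obtain ⟨P, hP, hPz⟩ := W.exists_formalParameter_eq_p_pow hn
  rcases P with _ | ⟨x, y, h⟩
  · exfalso
    have : (p : ℚ_[p]) ^ n = 0 := by rw [← hPz]; rfl
    exact pow_ne_zero n (Nat.cast_ne_zero.mpr (Fact.out : p.Prime).ne_zero) this
  rw [W.formalParameter_some h] at hPz
  have hx : 1 < ‖x‖ := hP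
  obtain ⟨hy0, hu0, hu1, -, -⟩ := W.param_facts h.1 hx
  set u : ℚ_[p] := -x / y with hu
  -- `H(u, 0) = (1 - c₁₀) u`
  have hF0 : padicEval₂ W.formalGroupLaw u 0 = u := padicEval₂_formalGroupLaw_zero_right h hx
  have hC₁ : IsPadicInt (MvPowerSeries.C c₁₀ : MvPowerSeries (Fin 2) ℚ_[p]) :=
    IsPadicInt.C (W.isPadicInt_formalGroupLaw _)
  have hC₂ : IsPadicInt (MvPowerSeries.C c₀₁ : MvPowerSeries (Fin 2) ℚ_[p]) :=
    IsPadicInt.C (W.isPadicInt_formalGroupLaw _)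
  have hHu : padicEval₂ H u 0 = (1 - c₁₀) * u := by
    rw [hH, padicEval₂_sub (W.isPadicInt_formalGroupLaw.sub (hC₁.mul (IsPadicInt.X 0)))
        (hC₂.mul (IsPadicInt.X 1)) hu1 h01,
      padicEval₂_sub W.isPadicInt_formalGroupLaw (hC₁.mul (IsPadicInt.X 0)) hu1 h01,
      padicEval₂_mul hC₁ (IsPadicInt.X 0) hu1 h01, padicEval₂_mul hC₂ (IsPadicInt.X 1) hu1 h01,
      padicEval₂_C, padicEval₂_C, padicEval₂_X, padicEval₂_X, hF0]
    simp only [Matrix.cons_val_zero, Matrix.cons_val_one]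
    ring
  -- `‖H(u, 0)‖ ≤ ‖u‖²`
  have hHle : ‖padicEval₂ H u 0‖ ≤ ‖u‖ ^ 2 := by
    have := norm_padicEval₂_le_max_pow hHint (m := 2)
      (W.coeff_formalGroupLaw_sub_linear_eq_zero) hu1 h01
    rwa [norm_zero, max_eq_left (norm_nonneg u)] at this
  rw [hHu, norm_mul, pow_two] at hHle
  have hupos : 0 < ‖u‖ := norm_pos_iff.mpr hu0
  have hle : ‖1 - c₁₀‖ ≤ ‖u‖ := le_of_mul_le_mul_right hHle hupos
  have hun : ‖u‖ = ((p : ℝ)⁻¹) ^ n := by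
    rw [hPz, Padic.norm_p_pow, zpow_neg, zpow_natCast, inv_pow]
  exact hun ▸ hle

/-- **The linear coefficient of `z₂` in `F` is `1`** (same argument with `F(0, z(Q)) = z(Q)`).
[Silverman AEC IV.2.1 / IV.1] [cite: SilvermanAEC2009, IV.1.1] -/
theorem coeff_single_one_formalGroupLaw :
    MvPowerSeries.coeff (Finsupp.single 1 1) W.formalGroupLaw = 1 := by
  set c₁₀ := MvPowerSeries.coeff (Finsupp.single 0 1) W.formalGroupLaw with hc₁₀
  set c₀₁ := MvPowerSeries.coeff (Finsupp.single 1 1) W.formalGroupLaw with hc₀₁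
  set H := W.formalGroupLaw - MvPowerSeries.C c₁₀ * MvPowerSeries.X 0 -
    MvPowerSeries.C c₀₁ * MvPowerSeries.X 1 with hH
  have hHint : IsPadicInt H := W.isPadicInt_formalGroupLaw_sub_linear
  have h01 : ‖(0 : ℚ_[p])‖ < 1 := by rw [norm_zero]; exact one_pos
  suffices hkey : ∀ n : ℕ, 1 ≤ n → ‖1 - c₀₁‖ ≤ ((p : ℝ)⁻¹) ^ n by
    have := padic_eq_zero_of_norm_le_p_pow hkey
    linear_combination -this
  intro n hn
  obtain ⟨P, hP, hPz⟩ := W.exists_formalParameter_eq_p_pow hn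
  rcases P with _ | ⟨x, y, h⟩
  · exfalso
    have : (p : ℚ_[p]) ^ n = 0 := by rw [← hPz]; rfl
    exact pow_ne_zero n (Nat.cast_ne_zero.mpr (Fact.out : p.Prime).ne_zero) this
  rw [W.formalParameter_some h] at hPz
  have hx : 1 < ‖x‖ := hP
  obtain ⟨hy0, hu0, hu1, -, -⟩ := W.param_facts h.1 hx
  set u : ℚ_[p] := -x / y with hu
  have hF0 : padicEval₂ W.formalGroupLaw 0 u = u := padicEval₂_formalGroupLaw_zero_left h hx
  have hC₁ : IsPadicInt (MvPowerSeries.C c₁₀ : MvPowerSeries (Fin 2) ℚ_[p]) :=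
    IsPadicInt.C (W.isPadicInt_formalGroupLaw _)
  have hC₂ : IsPadicInt (MvPowerSeries.C c₀₁ : MvPowerSeries (Fin 2) ℚ_[p]) :=
    IsPadicInt.C (W.isPadicInt_formalGroupLaw _)
  have hHu : padicEval₂ H 0 u = (1 - c₀₁) * u := by
    rw [hH, padicEval₂_sub (W.isPadicInt_formalGroupLaw.sub (hC₁.mul (IsPadicInt.X 0)))
        (hC₂.mul (IsPadicInt.X 1)) h01 hu1,
      padicEval₂_sub W.isPadicInt_formalGroupLaw (hC₁.mul (IsPadicInt.X 0)) h01 hu1,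
      padicEval₂_mul hC₁ (IsPadicInt.X 0) h01 hu1, padicEval₂_mul hC₂ (IsPadicInt.X 1) h01 hu1,
      padicEval₂_C, padicEval₂_C, padicEval₂_X, padicEval₂_X, hF0]
    simp only [Matrix.cons_val_zero, Matrix.cons_val_one]
    ring
  have hHle : ‖padicEval₂ H 0 u‖ ≤ ‖u‖ ^ 2 := by
    have := norm_padicEval₂_le_max_pow hHint (m := 2)
      (W.coeff_formalGroupLaw_sub_linear_eq_zero) h01 hu1
    rwa [norm_zero, max_eq_right (norm_nonneg u)] at this
  rw [hHu, norm_mul, pow_two] at hHle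
  have hupos : 0 < ‖u‖ := norm_pos_iff.mpr hu0
  have hle : ‖1 - c₀₁‖ ≤ ‖u‖ := le_of_mul_le_mul_right hHle hupos
  have hun : ‖u‖ = ((p : ℝ)⁻¹) ^ n := by
    rw [hPz, Padic.norm_p_pow, zpow_neg, zpow_natCast, inv_pow]
  exact hun ▸ hle

/-- Hence `F - z₁ - z₂` is integral without terms of degree `< 2`. [Silverman AEC IV.2.1]
[folklore] -/
theorem coeff_formalGroupLaw_sub_X_sub_X_eq_zero (d : Fin 2 →₀ ℕ) (hd : d 0 + d 1 < 2) :
    MvPowerSeries.coeff d (W.formalGroupLaw - MvPowerSeries.X 0 - MvPowerSeries.X 1) = 0 := by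
  have h := W.coeff_formalGroupLaw_sub_linear_eq_zero d hd
  rwa [W.coeff_single_zero_formalGroupLaw, W.coeff_single_one_formalGroupLaw, map_one, one_mul,
    one_mul] at h

/-- **`‖z(P + Q) - z(P) - z(Q)‖ ≤ max(‖z(P)‖, ‖z(Q)‖)²` on `E₁(ℚ_p)`**: the group law is
`z₁ + z₂` up to terms of degree `≥ 2` with integral coefficients (AEC IV.2: `F(X, Y) = X + Y +`
(terms of degree `≥ 2`)), evaluated through `F(z(P), z(Q)) = z(P + Q)` (AEC VII.2.2).
[cite: SilvermanAEC2009, VII.2.2] -/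
theorem norm_formalParameter_add_sub_sub_le {P Q : W.toAffine.Point} (hP : W.IsInReductionKernel P)
    (hQ : W.IsInReductionKernel Q) :
    ‖W.formalParameter (P + Q) - W.formalParameter P - W.formalParameter Q‖ ≤
      (max ‖W.formalParameter P‖ ‖W.formalParameter Q‖) ^ 2 := by
  have hu := W.norm_formalParameter_lt_one hP
  have hv := W.norm_formalParameter_lt_one hQ
  rw [← formalGroupLaw_padicEval_holds p W P Q hP hQ]
  have hG : IsPadicInt (W.formalGroupLaw - MvPowerSeries.X 0 - MvPowerSeries.X 1) :=
    (W.isPadicInt_formalGroupLaw.sub (IsPadicInt.X 0)).sub (IsPadicInt.X 1)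
  have h := norm_padicEval₂_le_max_pow hG (m := 2) W.coeff_formalGroupLaw_sub_X_sub_X_eq_zero hu hv
  rw [padicEval₂_sub (W.isPadicInt_formalGroupLaw.sub (IsPadicInt.X 0)) (IsPadicInt.X 1) hu hv,
    padicEval₂_sub W.isPadicInt_formalGroupLaw (IsPadicInt.X 0) hu hv, padicEval₂_X, padicEval₂_X] at h
  simp only [Matrix.cons_val_zero, Matrix.cons_val_one, Matrix.cons_val_fin_one] at h
  exact h

end LinearPart

/-! ### The filtration `E₁(ℚ_p) = E⁽⁰⁾ ⊇ E⁽¹⁾ ⊇ E⁽²⁾ ⊇ ⋯` and the limit logarithm -/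

section Filtration

variable [hW : W.IsIntegral ℤ_[p]] [W.IsElliptic]

/-- **The filtration of `E₁(ℚ_p)` by the size of the parameter**: for `n : ℕ`,
`E⁽ⁿ⁾(ℚ_p) = {P ∈ E₁(ℚ_p) : ‖z(P)‖ ≤ p⁻ⁿ}` (`O` included, `z(O) = 0`), an additive subgroup of
`E(ℚ_p)` — the image of `Ê(𝓜ⁿ) ⊂ Ê(𝓜)` (`𝓜 = pℤ_p`; Silverman AEC IV.3.2: "`Ê(𝓜ⁿ)` is a subgroup")
under the dictionary `E₁(ℚ_p) ≅ Ê(𝓜)`, `P ↦ z(P) = -x/y` (AEC VII.2.2); `E⁽⁰⁾ = E₁(ℚ_p)` as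
`‖z(P)‖ < 1` there, and for `n ≥ 1`, `P = (x, y) ∈ E⁽ⁿ⁾ ↔ v_p(x) ≤ -2n`. Closure under `+`/`-`:
`‖z(P + Q)‖ ≤ max(‖z(P)‖, ‖z(Q)‖)` (`z(P+Q) = F(z(P), z(Q))`, `F` integral without constant
term) and `‖z(-P)‖ = ‖z(P)‖`. Requires a `p`-integral equation of an elliptic curve.
A deliberate dot-notation extension of Mathlib's `WeierstrassCurve`, as the rest of the formal-group
layer (`FormalGroup.lean`). [Silverman AEC IV.3.2(a), VII.2.2; cf. Exercise 7.4 (`E_n(K)`)]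
[cite: SilvermanAEC2009, VII.2.2] -/
def formalFiltration (n : ℕ) : AddSubgroup W.toAffine.Point where
  carrier := {P | W.IsInReductionKernel P ∧ ‖W.formalParameter P‖ ≤ ((p : ℝ)⁻¹) ^ n}
  zero_mem' := ⟨W.isInReductionKernel_zero, by
    rw [W.formalParameter_zero, norm_zero]; exact pow_nonneg (inv_nonneg.mpr (Nat.cast_nonneg p)) n⟩
  add_mem' := fun {P Q} hP hQ => ⟨isInReductionKernel_add hP.1 hQ.1,
    (W.norm_formalParameter_add_le hP.1 hQ.1).trans (max_le hP.2 hQ.2)⟩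
  neg_mem' := fun {P} hP => ⟨W.isInReductionKernel_neg hP.1, by
    rw [W.norm_formalParameter_neg hP.1]; exact hP.2⟩

/-- Membership in `E⁽ⁿ⁾(ℚ_p)`. [Silverman AEC VII.2.2] [folklore] -/
theorem mem_formalFiltration_iff {n : ℕ} {P : W.toAffine.Point} :
    P ∈ W.formalFiltration n ↔ W.IsInReductionKernel P ∧ ‖W.formalParameter P‖ ≤ ((p : ℝ)⁻¹) ^ n :=
  Iff.rfl

/-- `E⁽⁰⁾(ℚ_p) = E₁(ℚ_p)` (`‖z(P)‖ < 1` on `E₁`). [Silverman AEC VII.2.2] [folklore] -/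
theorem mem_formalFiltration_zero_iff {P : W.toAffine.Point} :
    P ∈ W.formalFiltration 0 ↔ W.IsInReductionKernel P :=
  ⟨fun h => h.1, fun h => ⟨h, by rw [pow_zero]; exact (W.norm_formalParameter_lt_one h).le⟩⟩

/-- The filtration is decreasing: `E⁽ᵐ⁾ ⊆ E⁽ⁿ⁾` for `n ≤ m`. [Silverman AEC IV.3.2] [folklore] -/
theorem formalFiltration_antitone : Antitone W.formalFiltration := by
  intro n m hnm P hP
  refine ⟨hP.1, hP.2.trans ?_⟩
  have hp1 : 1 < (p : ℝ) := by exact_mod_cast (Fact.out : p.Prime).one_lt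
  exact pow_le_pow_of_le_one (inv_nonneg.mpr (zero_le_one.trans hp1.le))
    (inv_le_one_of_one_le₀ hp1.le) hnm

end Filtration

section LimitLog

/-- **The limit logarithm** `L(P) = lim_{k → ∞} z(pᵏP)/pᵏ ∈ ℚ_p` of a point of `E₁(ℚ_p)` (a
`limUnder`, junk where the limit does not exist; it exists when `‖z(P)‖ < p⁻¹`, companion file).
This is the device by which the companion files prove Silverman AEC Prop. VII.6.3 (`E(ℚ_p)` has a
finite-index subgroup `≅ ℤ_p⁺`) WITHOUT the formal logarithm of AEC IV.5–IV.6: additivity of `L` is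
inherited from `pᵏ(P + Q) = pᵏP + pᵏQ` in the group `E(ℚ_p)` and `z(P + Q) = z(P) + z(Q) + O(2)`.
(Where `log_Ê` of AEC IV.6.4 converges, `L(P) = log_Ê(z(P))`, since `log_Ê([pᵏ]z) = pᵏ log_Ê(z)`
and `log_Ê(t) = t + O(t²)`; this identification is neither used nor proved here.)
A deliberate dot-notation extension of Mathlib's `WeierstrassCurve`.
[Silverman AEC IV.6.4(b), VII.6.3 (the subgroup `≅ R⁺`)] [cite: SilvermanAEC2009, VII.6.3] -/
def padicLimitLog (P : W.toAffine.Point) : ℚ_[p] :=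
  limUnder atTop fun k : ℕ => W.formalParameter ((p ^ k : ℕ) • P) / (p : ℚ_[p]) ^ k

/-- The sequence whose limit is `L(P)`. [folklore] -/
theorem padicLimitLog_def (P : W.toAffine.Point) : W.padicLimitLog P =
    limUnder atTop (fun k : ℕ => W.formalParameter ((p ^ k : ℕ) • P) / (p : ℚ_[p]) ^ k) := rfl

/-- `L(O) = 0`. [folklore] -/
@[simp] theorem padicLimitLog_zero : W.padicLimitLog 0 = 0 := by
  rw [padicLimitLog_def]
  have : (fun k : ℕ => W.formalParameter ((p ^ k : ℕ) • (0 : W.toAffine.Point)) / (p : ℚ_[p]) ^ k) =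
      fun _ => 0 := by
    funext k; rw [nsmul_zero, W.formalParameter_zero, zero_div]
  rw [this]
  exact tendsto_const_nhds.limUnder_eq

end LimitLog

end WeierstrassCurve
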